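import Literature.NumberTheory.Rogawski1990.ArchCompatibleFamilies
import Literature.NumberTheory.Rogawski1990.EndoscopicCentralizerIso
import Literature.NumberTheory.Rogawski1990.ArchOrbitalMeasureRegular
import Literature.NumberTheory.Automorphic.UnitaryGroupOfLocalTorusMeasure
import HarnessLib

/-!
# Haar measures on the archimedean centralisers and their transport along `ι_∞`: the `H_∞` half of print's measure convention for GIVEN torus measures on
# `G_∞ = U(Φ₃)(L⁺ ⊗ ℝ)` (Rogawski 1990, §1.7 p. 6, §4.3 p. 43; Langlands–Shelstad 1987, §1.3–1.4; Deitmar–Echterhoff 2014, Thm. 1.5.3)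

Topic `NumberTheory/Rogawski1990`; namespaces `Literature.NumberTheory.Automorphic` (§§1–2, generic ∕ `UnitaryGroup`) and `Literature.NumberTheory.Rogawski1990`
(§§3–4).  THEOREMS ONLY (no definition, no named fact, no instance, no notation, no `sorry`).  Cell `pub/hodgecm-mathlib`, floor 0, F0∕P3a, crux H413, typer topic T6:
nodes **N10c + N10-ab** of the PAYABLE stub (M) `stub_archCompatibleFamilies_exists` of the pay-down line `Lines-draft/T6a_ArchTransfersCanonicalPaydown.lean`
(LEAD DESK WORD T6-6: holder B-p17 — head `ArchCompatibleFamiliesExist :: exists_archCompatibleFamilies`; N10a A-p13 `MeasureTheory/Group/HaarTransportGroupoid`; N10c this file;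
signatures (S2)(S3) = B-p17's interface census 15:31:22Z TOKEN FOR TOKEN).  From torus measures `t` on `G_∞` that are Haar at every regular element it produces `tH`, `mH` with
★ `ArchCompatibleFamiliesH L νH mH tH t` (conjuncts (W_H)(C_H) of ★ #77 `ArchTransfersExistCanonical`).

* §1 (generic) **`OrbitalMeasureFamily.exists_isQuotientOf`** — the WEIL-FORM CONSTRUCTOR: for centraliser measures `t` that are inversion-invariant Haar measures at the
  `P`-points, the family `c ↦ dν ∕ dt_{γ_c}` (★ `quotientMeasure`, junk `0` off `P`) satisfies ★ `OrbitalMeasureFamily.IsQuotientOf P ν t` (any Borel structures on the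
  orbit quotients — serves `m′`, `m`, `mH` of the line alike).
* §2 (N10-ab, (S2)) **`UnitaryGroup.isMulRightInvariant_of_isHaarMeasure_centralizer_arch`** ∕ **`…isInvInvariant…`** — for a REGULAR `γ ∈ U(J)(E ⊗ ℝ)` every Haar measure on
  the torus `Z(γ)` is right- and inversion-invariant (★ `centralizer_comm_of_isRegularElt_arch`: the centraliser is commutative; ★ `isMulRightInvariant_of_forall_comm`;
  ★ `isInvInvariant_of_isMulRightInvariant_of_isClosed`); **`UnitaryGroup.exists_isHaarMeasure_isInvInvariant_centralizer_arch`** — such a measure EXISTS (Mathlib `haar` on the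
  closed, hence locally compact, subgroup `Z(γ)`).
* §3 (N10c, (S3)) **`exists_centralizerMeasures_map_endoEmbArchCentralizer_eq`** — for `G`-regular `γ_H ∈ H_∞ = U(Φ₂)(L⁺ ⊗ ℝ) × U(Φ₁)(L⁺ ⊗ ℝ)` the (C_H) datum
  ★ `endoEmbArchCentralizer L γ_H : Z_{H_∞}(γ_H) →* Z_{G_∞}(ι_∞ γ_H)` underlies a `≃ₜ*` (★ `exists_continuousMulEquiv_coe_eq_endoEmbArchCentralizer`), so
  `tH γ_H := (t (ι_∞ γ_H)).map e⁻¹` is an inversion-invariant Haar measure with `map ι_∞|_{Z(γ_H)} (tH γ_H) = t (ι_∞ γ_H)` — print's «compatible measures on `H_{γ_H}` and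
  `G_γ`» (§4.3 p. 43) realised by transport, [LanglandsShelstad1987, (1.4)]; `centralizer_comm_of_isArchGRegular` (the torus `Z_{H_∞}(γ_H)` is commutative).
* §4 **`exists_archCompatibleFamiliesH`** — THE `H_∞` HALF CLOSED: `∃ mH tH, ArchCompatibleFamiliesH L νH mH tH t` for every Haar measure `νH` on `H_∞` and every `t` Haar at the
  regular elements of `G_∞`.
HONEST LABEL: HC_CM is proved only modulo the printed citations until rung 0 closes; this file is pure measure theory and pays nothing by itself (it is one third of (M)).

## References
* [Rogawski1990] J. D. Rogawski, *Automorphic Representations of Unitary Groups in Three Variables*, Ann. of Math. Stud. 123 (1990): §1.7 p. 6 (compatible Haar measures),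
  §4.3 (4.3.1) p. 43 (compatible measures on `H_{γ_H}` and `G_γ`), §4.8 Case (a) p. 53 (the embedding `ι`), §14.3 pp. 233–234.
* [LanglandsShelstad1987] R. P. Langlands, D. Shelstad, *On the definition of transfer factors*, Math. Ann. 278 (1987), §1.3–1.4 (measures on `T_H ≅ T_G` transported).
* [DeitmarEchterhoff2014] A. Deitmar, S. Echterhoff, *Principles of Harmonic Analysis*, 2nd ed. (2014), Thm. 1.5.3 (invariant quotient measures).
* [Folland1995] G. B. Folland, *A Course in Abstract Harmonic Analysis* (1995), Thm. 2.49 (abelian ⇒ unimodular), §2.2 (existence of Haar measure).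
-/

set_option autoImplicit false

noncomputable section

open MeasureTheory Measure NumberField IsDedekindDomain
open Literature.MeasureTheory.Group
open scoped Matrix MatrixGroups Classical

namespace Literature.NumberTheory.Automorphic

/-! ## §1 (generic) The Weil-form constructor: `c ↦ dν ∕ dt_{γ_c}` IS a quotient family of `ν` by `t` -/

section QuotientOf

variable {G : Type*} [Group G] [TopologicalSpace G] [IsTopologicalGroup G] [LocallyCompactSpace G] [SecondCountableTopology G]
  [T2Space G] [MeasurableSpace G] [BorelSpace G]
  [∀ γ : G, MeasurableSpace (G ⧸ Subgroup.centralizer ({γ} : Set G))]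
  [∀ γ : G, BorelSpace (G ⧸ Subgroup.centralizer ({γ} : Set G))]

/-- **WEIL-FORM CONSTRUCTOR.**  If the centraliser measure `t γ` is an inversion-invariant Haar measure on `G_γ` at every `P`-point `γ`, then there is an orbital measure
family `m` in Weil form for `(P, ν, t)` (★ `OrbitalMeasureFamily.IsQuotientOf`): `m c = dν ∕ dt_{γ_c}` (★ `quotientMeasure`, Deitmar–Echterhoff Thm. 1.5.3) at every class
`c` whose representative `γ_c = out c` satisfies `P` (junk `0` elsewhere — never read). [cite: DeitmarEchterhoff2014, Thm. 1.5.3] [cite: Rogawski1990, §1.7 p. 6; §4.3 (4.3.1) p. 43] -/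
theorem OrbitalMeasureFamily.exists_isQuotientOf (P : G → Prop) (ν : Measure G) [IsFiniteMeasureOnCompacts ν] [ν.IsMulRightInvariant]
    (t : ∀ γ : G, Measure (Subgroup.centralizer ({γ} : Set G)))
    (ht : ∀ γ : G, P γ → (t γ).IsHaarMeasure ∧ (t γ).IsInvInvariant) :
    ∃ m : OrbitalMeasureFamily G, m.IsQuotientOf P ν t := by
  refine ⟨fun c => if hc : P (Quotient.out c) then
      (haveI := (ht _ hc).1
       haveI := (ht _ hc).2
       quotientMeasure (Subgroup.centralizer ({(Quotient.out c : G)} : Set G)) (t (Quotient.out c))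
         (isClosed_coe_centralizer_singleton (Quotient.out c)) ν)
    else 0, fun c hc => ⟨(ht _ hc).1, (ht _ hc).2, ?_⟩⟩
  simp only [dif_pos hc]

end QuotientOf

/-! ## §2 (N10-ab) Regular `γ ∈ U(J)(E ⊗ ℝ)`: every Haar measure on the torus `Z(γ)` is right-invariant and inversion-invariant -/

namespace UnitaryGroup

section Generic

variable (E : Type) [Field E] [NumberField E] (F : Type) [Field F] [Algebra F E] (c : E ≃ₐ[F] E) (N : ℕ) (J : Matrix (Fin N) (Fin N) E)
  [MeasurableSpace (arch F E c N J)] [BorelSpace (arch F E c N J)]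

/-- **A Haar measure on the centraliser of a REGULAR `γ ∈ U(J)(E ⊗ ℝ)` is right-invariant**: the centraliser is commutative (★ `centralizer_comm_of_isRegularElt_arch`),
hence unimodular (★ `isMulRightInvariant_of_forall_comm`). [cite: Folland1995, Thm. 2.49] [cite: Rogawski1990, §3.1 p. 19] -/
theorem isMulRightInvariant_of_isHaarMeasure_centralizer_arch (γ : arch F E c N J)
    (hγ : Literature.NumberTheory.Rogawski1990.IsRegularElt (γ.val : GL (Fin N) (mixedEmbedding.mixedSpace E)))
    (μ : Measure (Subgroup.centralizer ({γ} : Set (arch F E c N J)))) [μ.IsHaarMeasure] : μ.IsMulRightInvariant :=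
  isMulRightInvariant_of_forall_comm (Subgroup.centralizer ({γ} : Set (arch F E c N J))) (isClosed_coe_centralizer_singleton γ)
    (centralizer_comm_of_isRegularElt_arch E F c N J γ hγ) μ

/-- **A Haar measure on the centraliser of a REGULAR `γ ∈ U(J)(E ⊗ ℝ)` is inversion-invariant** (right-invariant by the previous lemma, then
★ `isInvInvariant_of_isMulRightInvariant_of_isClosed` on the closed subgroup `Z(γ)`).  This is the «`t_γ` inversion-invariant» clause of ★ `OrbitalMeasureFamily.IsQuotientOf`
for every Haar torus measure at a regular point. [cite: Folland1995, Thm. 2.49] [cite: DeitmarEchterhoff2014, Thm. 1.5.3] -/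
theorem isInvInvariant_of_isHaarMeasure_centralizer_arch (γ : arch F E c N J)
    (hγ : Literature.NumberTheory.Rogawski1990.IsRegularElt (γ.val : GL (Fin N) (mixedEmbedding.mixedSpace E)))
    (μ : Measure (Subgroup.centralizer ({γ} : Set (arch F E c N J)))) [μ.IsHaarMeasure] : μ.IsInvInvariant := by
  haveI := isMulRightInvariant_of_isHaarMeasure_centralizer_arch E F c N J γ hγ μ
  exact isInvInvariant_of_isMulRightInvariant_of_isClosed (Subgroup.centralizer ({γ} : Set (arch F E c N J)))
    (isClosed_coe_centralizer_singleton γ) μ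

/-- Both invariances packaged as the hypothesis shape of ★ `OrbitalMeasureFamily.exists_isQuotientOf` at a regular point. [cite: DeitmarEchterhoff2014, Thm. 1.5.3] -/
theorem isHaarMeasure_and_isInvInvariant_centralizer_arch (γ : arch F E c N J)
    (hγ : Literature.NumberTheory.Rogawski1990.IsRegularElt (γ.val : GL (Fin N) (mixedEmbedding.mixedSpace E)))
    (μ : Measure (Subgroup.centralizer ({γ} : Set (arch F E c N J)))) [hμ : μ.IsHaarMeasure] : μ.IsHaarMeasure ∧ μ.IsInvInvariant :=
  ⟨hμ, isInvInvariant_of_isHaarMeasure_centralizer_arch E F c N J γ hγ μ⟩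

end Generic

/-- **(S2) An inversion-invariant Haar measure on the centraliser of a REGULAR `γ ∈ U(H)(L⁺ ⊗ ℝ)` EXISTS**: the centraliser is a closed subgroup of the locally compact
group `U(H)(L⁺ ⊗ ℝ)`, hence locally compact, so Mathlib's `haar` is a Haar measure on it; inversion-invariance is §2's `isInvInvariant_of_isHaarMeasure_centralizer_arch`
(the torus is commutative).  The base measures of the holder's transport system (B-p17 interface (S2), binders token for token). [cite: Folland1995, §2.2, Thm. 2.49]
[cite: Rogawski1990, §1.7 p. 6 «All measures on groups are assumed to be Haar measures»] -/
theorem exists_isHaarMeasure_isInvInvariant_centralizer_arch (L : Type) [Field L] [NumberField L] [IsCMField L] {N : ℕ} {H : Matrix (Fin N) (Fin N) L}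
    [MeasurableSpace (arch (↥(maximalRealSubfield L)) L (IsCMField.complexConj L) N H)] [BorelSpace (arch (↥(maximalRealSubfield L)) L (IsCMField.complexConj L) N H)]
    (γ : arch (↥(maximalRealSubfield L)) L (IsCMField.complexConj L) N H) (hγ : Literature.NumberTheory.Rogawski1990.IsRegularElt (γ.val : GL (Fin N) (mixedEmbedding.mixedSpace L))) :
    ∃ μ : Measure (Subgroup.centralizer ({γ} : Set (arch (↥(maximalRealSubfield L)) L (IsCMField.complexConj L) N H))), μ.IsHaarMeasure ∧ μ.IsInvInvariant := by
  haveI : LocallyCompactSpace (Subgroup.centralizer ({γ} : Set (arch (↥(maximalRealSubfield L)) L (IsCMField.complexConj L) N H))) :=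
    (isClosed_coe_centralizer_singleton γ).isClosedEmbedding_subtypeVal.locallyCompactSpace
  exact ⟨haar, inferInstance,
    isInvInvariant_of_isHaarMeasure_centralizer_arch L (↥(maximalRealSubfield L)) (IsCMField.complexConj L) N H γ hγ haar⟩

end UnitaryGroup

end Literature.NumberTheory.Automorphic

namespace Literature.NumberTheory.Rogawski1990

open Literature.NumberTheory.Automorphic
open Literature.AlgebraicGeometry.ShimuraVarieties (unitaryGroup hermForm)

/-! ## §3 (N10c) The torus measures on `H_∞` by transport along `ι_∞|_{Z(γ_H)} : Z_{H_∞}(γ_H) ≃ₜ* Z_{G_∞}(ι_∞ γ_H)` -/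

section ArchH

variable (L : Type) [Field L] [NumberField L] [IsCMField L]

/-- **The centraliser of a `G`-regular `γ_H ∈ H_∞` is commutative**: `ι_∞|_{Z(γ_H)}` (★ `endoEmbArchCentralizer`) is an injective homomorphism into the commutative
torus `Z_{G_∞}(ι_∞ γ_H)` (★ `centralizer_comm_of_isRegularElt_arch`). [cite: Rogawski1990, §4.3 pp. 42–44; §3.1 p. 19] -/
theorem centralizer_comm_of_isArchGRegular
    (γH : UnitaryGroup.arch (↥(maximalRealSubfield L)) L (IsCMField.complexConj L) 2 (Matrix.of fun i j : Fin 2 => if i.val + j.val + 1 = 2 then (1 : L) else 0) ×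
      UnitaryGroup.arch (↥(maximalRealSubfield L)) L (IsCMField.complexConj L) 1 (Matrix.of fun i j : Fin 1 => if i.val + j.val + 1 = 1 then (1 : L) else 0))
    (hreg : IsArchGRegular L γH) :
    ∀ a ∈ Subgroup.centralizer ({γH} : Set _), ∀ b ∈ Subgroup.centralizer ({γH} : Set _), a * b = b * a := by
  intro a ha b hb
  have hG := UnitaryGroup.centralizer_comm_of_isRegularElt_arch L (↥(maximalRealSubfield L)) (IsCMField.complexConj L) 3
    (Matrix.of fun i j : Fin 3 => if i.val + j.val + 1 = 3 then (1 : L) else 0) (endoEmbArch L γH) hreg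
  have hab : endoEmbArchCentralizer L γH (⟨a, ha⟩ * ⟨b, hb⟩) = endoEmbArchCentralizer L γH (⟨b, hb⟩ * ⟨a, ha⟩) := by
    rw [map_mul, map_mul]
    exact Subtype.ext (hG _ (endoEmbArchCentralizer L γH ⟨a, ha⟩).2 _ (endoEmbArchCentralizer L γH ⟨b, hb⟩).2)
  exact congrArg Subtype.val (endoEmbArchCentralizer_injective L γH hab)

variable
    [MeasurableSpace (UnitaryGroup.arch (↥(maximalRealSubfield L)) L (IsCMField.complexConj L) 2 (Matrix.of fun i j : Fin 2 => if i.val + j.val + 1 = 2 then (1 : L) else 0) ×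
      UnitaryGroup.arch (↥(maximalRealSubfield L)) L (IsCMField.complexConj L) 1 (Matrix.of fun i j : Fin 1 => if i.val + j.val + 1 = 1 then (1 : L) else 0))]
    [BorelSpace (UnitaryGroup.arch (↥(maximalRealSubfield L)) L (IsCMField.complexConj L) 2 (Matrix.of fun i j : Fin 2 => if i.val + j.val + 1 = 2 then (1 : L) else 0) ×
      UnitaryGroup.arch (↥(maximalRealSubfield L)) L (IsCMField.complexConj L) 1 (Matrix.of fun i j : Fin 1 => if i.val + j.val + 1 = 1 then (1 : L) else 0))]
    [MeasurableSpace (UnitaryGroup.arch (↥(maximalRealSubfield L)) L (IsCMField.complexConj L) 3 (Matrix.of fun i j : Fin 3 => if i.val + j.val + 1 = 3 then (1 : L) else 0))]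
    [BorelSpace (UnitaryGroup.arch (↥(maximalRealSubfield L)) L (IsCMField.complexConj L) 3 (Matrix.of fun i j : Fin 3 => if i.val + j.val + 1 = 3 then (1 : L) else 0))]

/-- **(N10c) TORUS MEASURES ON `H_∞` BY TRANSPORT (Haar-only hypothesis).**  Given centraliser measures `t` on `G_∞ = U(Φ₃)(L⁺ ⊗ ℝ)` that are Haar measures at every regular element, there are
centraliser measures `tH` on `H_∞ = U(Φ₂)(L⁺ ⊗ ℝ) × U(Φ₁)(L⁺ ⊗ ℝ)` such that at every `G`-regular `γ_H`: `tH γ_H` is an inversion-invariant Haar measure on `Z(γ_H)`, and the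
(C_H) datum ★ `endoEmbArchCentralizer L γ_H` carries `tH γ_H` to `t (ι_∞ γ_H)` — `tH γ_H := (t (ι_∞ γ_H)).map e⁻¹` for the topological-group isomorphism `e` underlying
`ι_∞|_{Z(γ_H)}` (★ `exists_continuousMulEquiv_coe_eq_endoEmbArchCentralizer`); junk `0` at non-`G`-regular points (never read).  Print: «the orbital integrals are defined
using compatible measures on `H_{γ′}` and `G_γ`» (§4.3 p. 43); [LanglandsShelstad1987, (1.4)]: the measures on `T_H ≅ T_G` are transported along the admissible isomorphism.
[cite: Rogawski1990, §4.3 (4.3.1) p. 43; §1.7 p. 6] [cite: LanglandsShelstad1987, §1.3–1.4] -/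
theorem exists_centralizerMeasures_map_endoEmbArchCentralizer_eq_of_isHaarMeasure
    (t : ∀ γ : UnitaryGroup.arch (↥(maximalRealSubfield L)) L (IsCMField.complexConj L) 3 (Matrix.of fun i j : Fin 3 => if i.val + j.val + 1 = 3 then (1 : L) else 0),
      Measure (Subgroup.centralizer ({γ} : Set (UnitaryGroup.arch (↥(maximalRealSubfield L)) L (IsCMField.complexConj L) 3
        (Matrix.of fun i j : Fin 3 => if i.val + j.val + 1 = 3 then (1 : L) else 0)))))
    (ht : ∀ γ : UnitaryGroup.arch (↥(maximalRealSubfield L)) L (IsCMField.complexConj L) 3 (Matrix.of fun i j : Fin 3 => if i.val + j.val + 1 = 3 then (1 : L) else 0),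
      IsRegularElt (γ.val : GL (Fin 3) (mixedEmbedding.mixedSpace L)) → (t γ).IsHaarMeasure) :
    ∃ tH : ∀ γH : UnitaryGroup.arch (↥(maximalRealSubfield L)) L (IsCMField.complexConj L) 2 (Matrix.of fun i j : Fin 2 => if i.val + j.val + 1 = 2 then (1 : L) else 0) ×
          UnitaryGroup.arch (↥(maximalRealSubfield L)) L (IsCMField.complexConj L) 1 (Matrix.of fun i j : Fin 1 => if i.val + j.val + 1 = 1 then (1 : L) else 0),
        Measure (Subgroup.centralizer ({γH} : Set (UnitaryGroup.arch (↥(maximalRealSubfield L)) L (IsCMField.complexConj L) 2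
            (Matrix.of fun i j : Fin 2 => if i.val + j.val + 1 = 2 then (1 : L) else 0) ×
          UnitaryGroup.arch (↥(maximalRealSubfield L)) L (IsCMField.complexConj L) 1 (Matrix.of fun i j : Fin 1 => if i.val + j.val + 1 = 1 then (1 : L) else 0)))),
      (∀ γH, IsArchGRegular L γH → (tH γH).IsHaarMeasure ∧ (tH γH).IsInvInvariant) ∧
      (∀ γH, IsArchGRegular L γH → Measure.map ⇑(endoEmbArchCentralizer L γH) (tH γH) = t (endoEmbArch L γH)) := by
  have key : ∀ γH : UnitaryGroup.arch (↥(maximalRealSubfield L)) L (IsCMField.complexConj L) 2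
        (Matrix.of fun i j : Fin 2 => if i.val + j.val + 1 = 2 then (1 : L) else 0) ×
      UnitaryGroup.arch (↥(maximalRealSubfield L)) L (IsCMField.complexConj L) 1 (Matrix.of fun i j : Fin 1 => if i.val + j.val + 1 = 1 then (1 : L) else 0),
      IsArchGRegular L γH → ∃ e : Subgroup.centralizer ({γH} : Set _) ≃ₜ* Subgroup.centralizer ({endoEmbArch L γH} : Set _),
        ⇑e = ⇑(endoEmbArchCentralizer L γH) :=
    fun γH h => exists_continuousMulEquiv_coe_eq_endoEmbArchCentralizer L h
  choose e he using key
  refine ⟨fun γH => if h : IsArchGRegular L γH then Measure.map ⇑(e γH h).symm (t (endoEmbArch L γH)) else 0, ?_, ?_⟩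
  · intro γH h
    have hreg : IsRegularElt ((endoEmbArch L γH).val : GL (Fin 3) (mixedEmbedding.mixedSpace L)) := h
    haveI := ht _ hreg
    simp only [dif_pos h]
    haveI hHaar : (Measure.map ⇑(e γH h).symm (t (endoEmbArch L γH))).IsHaarMeasure := (e γH h).symm.isHaarMeasure_map _
    refine ⟨hHaar, ?_⟩
    haveI := isMulRightInvariant_of_forall_comm (Subgroup.centralizer ({γH} : Set _)) (isClosed_coe_centralizer_singleton γH)
      (centralizer_comm_of_isArchGRegular L γH h) (Measure.map ⇑(e γH h).symm (t (endoEmbArch L γH)))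
    exact isInvInvariant_of_isMulRightInvariant_of_isClosed (Subgroup.centralizer ({γH} : Set _)) (isClosed_coe_centralizer_singleton γH) _
  · intro γH h
    simp only [dif_pos h]
    have hm₁ : Measurable (⇑(e γH h)) := (e γH h).continuous.measurable
    have hm₂ : Measurable (⇑(e γH h).symm) := (e γH h).symm.continuous.measurable
    rw [← he γH h, Measure.map_map hm₁ hm₂]
    have hid : (⇑(e γH h) ∘ ⇑(e γH h).symm) = id := by
      funext z
      exact (e γH h).apply_symm_apply z
    rw [hid, Measure.map_id]

/-- **(S3) TORUS MEASURES ON `H_∞` BY TRANSPORT — the holder's interface** (B-p17 census 15:31:22Z, token for token): for centraliser measures `t` on `G_∞` that are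
inversion-invariant Haar measures at the regular elements, `tH` on `H_∞` with (W_H)-readiness (inversion-invariant Haar at the `G`-regular points) and the (C_H) law
`map ι_∞|_{Z(γ_H)} (tH γ_H) = t (ι_∞ γ_H)` (the inversion clause of `ht` is not needed for the construction and is dropped through the `_of_isHaarMeasure` form).
[cite: Rogawski1990, §4.3 (4.3.1) p. 43; §1.7 p. 6] [cite: LanglandsShelstad1987, §1.3–1.4] -/
theorem exists_centralizerMeasures_map_endoEmbArchCentralizer_eq
    (t : ∀ γ : UnitaryGroup.arch (↥(maximalRealSubfield L)) L (IsCMField.complexConj L) 3 (Matrix.of fun i j : Fin 3 => if i.val + j.val + 1 = 3 then (1 : L) else 0),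
      Measure (Subgroup.centralizer ({γ} : Set (UnitaryGroup.arch (↥(maximalRealSubfield L)) L (IsCMField.complexConj L) 3
        (Matrix.of fun i j : Fin 3 => if i.val + j.val + 1 = 3 then (1 : L) else 0)))))
    (ht : ∀ γ : UnitaryGroup.arch (↥(maximalRealSubfield L)) L (IsCMField.complexConj L) 3 (Matrix.of fun i j : Fin 3 => if i.val + j.val + 1 = 3 then (1 : L) else 0),
      IsRegularElt (γ.val : GL (Fin 3) (mixedEmbedding.mixedSpace L)) → (t γ).IsHaarMeasure ∧ (t γ).IsInvInvariant) :
    ∃ tH : ∀ γH : UnitaryGroup.arch (↥(maximalRealSubfield L)) L (IsCMField.complexConj L) 2 (Matrix.of fun i j : Fin 2 => if i.val + j.val + 1 = 2 then (1 : L) else 0) ×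
          UnitaryGroup.arch (↥(maximalRealSubfield L)) L (IsCMField.complexConj L) 1 (Matrix.of fun i j : Fin 1 => if i.val + j.val + 1 = 1 then (1 : L) else 0),
        Measure (Subgroup.centralizer ({γH} : Set (UnitaryGroup.arch (↥(maximalRealSubfield L)) L (IsCMField.complexConj L) 2
            (Matrix.of fun i j : Fin 2 => if i.val + j.val + 1 = 2 then (1 : L) else 0) ×
          UnitaryGroup.arch (↥(maximalRealSubfield L)) L (IsCMField.complexConj L) 1 (Matrix.of fun i j : Fin 1 => if i.val + j.val + 1 = 1 then (1 : L) else 0)))),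
      (∀ γH : UnitaryGroup.arch (↥(maximalRealSubfield L)) L (IsCMField.complexConj L) 2 (Matrix.of fun i j : Fin 2 => if i.val + j.val + 1 = 2 then (1 : L) else 0) ×
          UnitaryGroup.arch (↥(maximalRealSubfield L)) L (IsCMField.complexConj L) 1 (Matrix.of fun i j : Fin 1 => if i.val + j.val + 1 = 1 then (1 : L) else 0),
        IsArchGRegular L γH → (tH γH).IsHaarMeasure ∧ (tH γH).IsInvInvariant) ∧
      (∀ γH : UnitaryGroup.arch (↥(maximalRealSubfield L)) L (IsCMField.complexConj L) 2 (Matrix.of fun i j : Fin 2 => if i.val + j.val + 1 = 2 then (1 : L) else 0) ×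
          UnitaryGroup.arch (↥(maximalRealSubfield L)) L (IsCMField.complexConj L) 1 (Matrix.of fun i j : Fin 1 => if i.val + j.val + 1 = 1 then (1 : L) else 0),
        IsArchGRegular L γH → Measure.map ⇑(endoEmbArchCentralizer L γH) (tH γH) = t (endoEmbArch L γH)) :=
  exists_centralizerMeasures_map_endoEmbArchCentralizer_eq_of_isHaarMeasure L t fun γ h => (ht γ h).1

/-! ## §4 The `H_∞` half of the measure convention is satisfiable for GIVEN torus measures on `G_∞` -/

/-- **THE `H_∞` HALF CLOSED.**  For every Haar measure `νH` on `H_∞` and every family `t` of centraliser measures on `G_∞` that are Haar measures at the regular elements,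
there are `mH` (orbital measure family on `H_∞`, Borel σ-algebras on the orbit quotients) and `tH` with ★ `ArchCompatibleFamiliesH L νH mH tH t`: (W_H) `mH = dνH ∕ dtH`
at the `G`-regular classes and (C_H) `ι_∞|_{Z(γ_H)}` carries `tH γ_H` to `t (ι_∞ γ_H)` — conjuncts 9 and 13 of ★ `ArchTransfersExistCanonical` for the given `t`.
[cite: Rogawski1990, §4.3 (4.3.1) p. 43; §1.7 p. 6; §14.3 pp. 233–234] [cite: LanglandsShelstad1987, §1.3–1.4] [cite: DeitmarEchterhoff2014, Thm. 1.5.3] -/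
theorem exists_archCompatibleFamiliesH
    (νH : Measure (UnitaryGroup.arch (↥(maximalRealSubfield L)) L (IsCMField.complexConj L) 2 (Matrix.of fun i j : Fin 2 => if i.val + j.val + 1 = 2 then (1 : L) else 0) ×
      UnitaryGroup.arch (↥(maximalRealSubfield L)) L (IsCMField.complexConj L) 1 (Matrix.of fun i j : Fin 1 => if i.val + j.val + 1 = 1 then (1 : L) else 0)))
    [νH.IsHaarMeasure] [νH.IsMulRightInvariant]
    (t : ∀ γ : UnitaryGroup.arch (↥(maximalRealSubfield L)) L (IsCMField.complexConj L) 3 (Matrix.of fun i j : Fin 3 => if i.val + j.val + 1 = 3 then (1 : L) else 0),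
      Measure (Subgroup.centralizer ({γ} : Set (UnitaryGroup.arch (↥(maximalRealSubfield L)) L (IsCMField.complexConj L) 3
        (Matrix.of fun i j : Fin 3 => if i.val + j.val + 1 = 3 then (1 : L) else 0)))))
    (ht : ∀ γ : UnitaryGroup.arch (↥(maximalRealSubfield L)) L (IsCMField.complexConj L) 3 (Matrix.of fun i j : Fin 3 => if i.val + j.val + 1 = 3 then (1 : L) else 0),
      IsRegularElt (γ.val : GL (Fin 3) (mixedEmbedding.mixedSpace L)) → (t γ).IsHaarMeasure) :
    ∃ (mH : @OrbitalMeasureFamily (UnitaryGroup.arch (↥(maximalRealSubfield L)) L (IsCMField.complexConj L) 2 (Matrix.of fun i j : Fin 2 => if i.val + j.val + 1 = 2 then (1 : L) else 0) ×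
          UnitaryGroup.arch (↥(maximalRealSubfield L)) L (IsCMField.complexConj L) 1 (Matrix.of fun i j : Fin 1 => if i.val + j.val + 1 = 1 then (1 : L) else 0)) _ (fun _ => borel _))
      (tH : ∀ γH : UnitaryGroup.arch (↥(maximalRealSubfield L)) L (IsCMField.complexConj L) 2 (Matrix.of fun i j : Fin 2 => if i.val + j.val + 1 = 2 then (1 : L) else 0) ×
          UnitaryGroup.arch (↥(maximalRealSubfield L)) L (IsCMField.complexConj L) 1 (Matrix.of fun i j : Fin 1 => if i.val + j.val + 1 = 1 then (1 : L) else 0),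
        Measure (Subgroup.centralizer ({γH} : Set (UnitaryGroup.arch (↥(maximalRealSubfield L)) L (IsCMField.complexConj L) 2
            (Matrix.of fun i j : Fin 2 => if i.val + j.val + 1 = 2 then (1 : L) else 0) ×
          UnitaryGroup.arch (↥(maximalRealSubfield L)) L (IsCMField.complexConj L) 1 (Matrix.of fun i j : Fin 1 => if i.val + j.val + 1 = 1 then (1 : L) else 0))))),
      ArchCompatibleFamiliesH L νH mH tH t := by
  letI : ∀ a : (UnitaryGroup.arch (↥(maximalRealSubfield L)) L (IsCMField.complexConj L) 2 (Matrix.of fun i j : Fin 2 => if i.val + j.val + 1 = 2 then (1 : L) else 0) ×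
        UnitaryGroup.arch (↥(maximalRealSubfield L)) L (IsCMField.complexConj L) 1 (Matrix.of fun i j : Fin 1 => if i.val + j.val + 1 = 1 then (1 : L) else 0)),
      MeasurableSpace ((UnitaryGroup.arch (↥(maximalRealSubfield L)) L (IsCMField.complexConj L) 2 (Matrix.of fun i j : Fin 2 => if i.val + j.val + 1 = 2 then (1 : L) else 0) ×
          UnitaryGroup.arch (↥(maximalRealSubfield L)) L (IsCMField.complexConj L) 1 (Matrix.of fun i j : Fin 1 => if i.val + j.val + 1 = 1 then (1 : L) else 0)) ⧸
        Subgroup.centralizer ({a} : Set ((UnitaryGroup.arch (↥(maximalRealSubfield L)) L (IsCMField.complexConj L) 2 (Matrix.of fun i j : Fin 2 => if i.val + j.val + 1 = 2 then (1 : L) else 0) ×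
          UnitaryGroup.arch (↥(maximalRealSubfield L)) L (IsCMField.complexConj L) 1 (Matrix.of fun i j : Fin 1 => if i.val + j.val + 1 = 1 then (1 : L) else 0))))) :=
    fun _ => borel _
  haveI : ∀ a : (UnitaryGroup.arch (↥(maximalRealSubfield L)) L (IsCMField.complexConj L) 2 (Matrix.of fun i j : Fin 2 => if i.val + j.val + 1 = 2 then (1 : L) else 0) ×
        UnitaryGroup.arch (↥(maximalRealSubfield L)) L (IsCMField.complexConj L) 1 (Matrix.of fun i j : Fin 1 => if i.val + j.val + 1 = 1 then (1 : L) else 0)),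
      BorelSpace ((UnitaryGroup.arch (↥(maximalRealSubfield L)) L (IsCMField.complexConj L) 2 (Matrix.of fun i j : Fin 2 => if i.val + j.val + 1 = 2 then (1 : L) else 0) ×
          UnitaryGroup.arch (↥(maximalRealSubfield L)) L (IsCMField.complexConj L) 1 (Matrix.of fun i j : Fin 1 => if i.val + j.val + 1 = 1 then (1 : L) else 0)) ⧸
        Subgroup.centralizer ({a} : Set ((UnitaryGroup.arch (↥(maximalRealSubfield L)) L (IsCMField.complexConj L) 2 (Matrix.of fun i j : Fin 2 => if i.val + j.val + 1 = 2 then (1 : L) else 0) ×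
          UnitaryGroup.arch (↥(maximalRealSubfield L)) L (IsCMField.complexConj L) 1 (Matrix.of fun i j : Fin 1 => if i.val + j.val + 1 = 1 then (1 : L) else 0))))) :=
    fun _ => ⟨rfl⟩
  obtain ⟨tH, hW, hC⟩ := exists_centralizerMeasures_map_endoEmbArchCentralizer_eq_of_isHaarMeasure L t ht
  obtain ⟨mH, hmH⟩ := OrbitalMeasureFamily.exists_isQuotientOf (IsArchGRegular L) νH tH hW
  exact ⟨mH, tH, hmH, hC⟩

end ArchH

end Literature.NumberTheory.Rogawski1990

end
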